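import Mathlib
import HarnessLib
import Summits.AtomisticToContinuum.FouriersLaw.Theses.JunctionLocality
import Summits.AtomisticToContinuum.FouriersLaw.Theorems.JunctionLocalitySuperadditiveResistanceDeviceLiouville
import Summits.AtomisticToContinuum.FouriersLaw.Theorems.JunctionLocalitySuperadditiveResistancePlainAdjoint
import Summits.AtomisticToContinuum.FouriersLaw.Theorems.JunctionLocalitySuperadditiveResistanceKuboGreen
import Summits.AtomisticToContinuum.FouriersLaw.Theorems.JunctionLocalitySuperadditiveResistanceStubBypassBoundAux2
import Summits.AtomisticToContinuum.FouriersLaw.Theorems.JunctionLocalityInsertionMollify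

/-!
# Energy row sum of the plain chain's forward field (stub `stub_rowSum` of line `ForecastSensitivitySketch`, crux stmt-AtomisticToContinuum-11749)

For the pinned anharmonic chain `pinnedChain ω₂ lam β γ` (all parameters `> 0`), `T > 0`, `L ≥ 2` and every
classical forward field of the LEFT bath — `g ∈ C² ∩ L²(μ_T)`, mean zero, `L_{T,T} g = −(p_0² − T)` pointwise —
the ENERGY ROW SUM holds:

  `⟨g, p_0² − T⟩_{μ_T} + ⟨g, p_{L−1}² − T⟩_{μ_T} = T² / γ`   (`stub_rowSum`).

Proof (all inputs landed in the tree, nothing taken as a named fact). Write `k_b = p_b² − T`, `X_H = liouvilleOp`,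
`S = bathOp L bathWeight T`, so that `L_{T,T} = X_H + γ S` (`generator_eq_liouvilleOp_add`) and `(g, k_0)` is a
forward pair: `X_H g + γ S g = −k_0`. Energy conservation in pair form: `X_H H = 0` (`liouvilleOp_hamiltonian`) and
`S H = −(k_0 + k_{L−1})` (`bathOp_bathWeight_hamiltonian`, from `∂_p H = p`, `∂_p² H = 1`), so `(H, γ(k_0 + k_{L−1}))`
is a BACKWARD pair (`−X_H H + γ S H = −γ(k_0 + k_{L−1})`). The cross Green identity of the landed Kubo toolkit
(`Kubo.cross_level`: forward pair against backward pair at energy-cutoff level `χ_n`) reads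
`∫ χ_n H k_0 ρ − ∫ χ_n g γ(k_0 + k_{L−1}) ρ = γT Σ_i B_i ∫ (H ∂_{p_i} g − g p_i) ∂_{p_i}χ_n ρ`, and the cutoff is
removed (`integral_cross_eq`, dominated convergence `tendsto_integral_chi_mul` /
`tendsto_integral_partialP_chi_mul`) because `H, p_i, k_b, g ∈ L²(μ_T)` and `∂_{p_b} g ∈ L²(μ_T)` at the
thermostatted sites (finite entropy production of forward fields, `Kubo.memLp_partialP`). Hence
`γ(⟨g, k_0⟩ + ⟨g, k_{L−1}⟩) = ⟨H, k_0⟩_{μ_T} = T⟨∂_{p_0}H, p_0⟩_{μ_T} = T⟨p_0²⟩_{μ_T} = T²` (Gaussian integration by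
parts `integral_mul_sq_sub_gibbsMeasure` and equipartition `pinnedChain_integral_snd_sq`).

References: Eckmann–Pillet–Rey-Bellet 1999 §3 (energy balance of the open chain); Rey-Bellet 2003, Rem. 4.4;
folklore.
-/

noncomputable section

open MeasureTheory Filter Topology
open scoped ContDiff
open Literature.MathematicalPhysics.KineticTheory.HeatConduction
open Summit.AtomisticToContinuum.FouriersLaw.Theorems.SuperadditiveResistance.DeviceLiouville
  (kin kin_eq_sq continuous_kin liouvilleOp bathOp generator_eq_liouvilleOp_add)
open Summit.AtomisticToContinuum.FouriersLaw.Theorems.SuperadditiveResistance.Kubo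
  (chi cross_level tendsto_integral_chi_mul tendsto_integral_partialP_chi_mul memLp_partialP
    integrable_mul_gibbsDensity_iff integrable_mul_mul_gibbsDensity continuous_source)
open Summit.AtomisticToContinuum.FouriersLaw.Cruxes.SuperadditiveResistance.FloatingProbeBypassLaplacian
  (pinnedChain_memLp_two_snd pinnedChain_memLp_two_snd_sq pinnedChain_integral_snd_sq
    integral_mul_sq_sub_gibbsMeasure)
open Summit.AtomisticToContinuum.FouriersLaw.Cruxes.SuperadditiveResistance.InsertionToolbox
  (pinnedChain_memLp_two_of_abs_le)

namespace Summit.AtomisticToContinuum.FouriersLaw.Cruxes.ConductanceLowerBound.ForecastSensitivity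

/-! ## Energy conservation in pair form: `X_H H = 0`, `S_{bathWeight} H = −(k_0 + k_{L−1})` -/

section Energy

variable {L : ℕ}

/-- A sum over `Fin L` of a single `val`-indicator picks out one value:
`Σ_i [i.val = s] f i = f ⟨s, _⟩` for `s < L`. [folklore] -/
theorem sum_ite_val_eq {s : ℕ} (hs : s < L) (f : Fin L → ℝ) :
    ∑ i : Fin L, (if i.val = s then f i else 0) = f ⟨s, hs⟩ := by
  rw [Finset.sum_eq_single_of_mem (⟨s, hs⟩ : Fin L) (Finset.mem_univ _)]
  · simp
  · intro b _ hb
    rw [if_neg]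
    exact fun h => hb (Fin.ext h)

/-- `∂²_{p_i} H = 1` for every chain. [folklore] -/
theorem partialP_partialP_hamiltonian' (P : OscillatorChain) (L : ℕ) (x : PhaseSpace L) (i : Fin L) :
    partialP i (partialP i (P.hamiltonian L)) x = 1 := by
  -- adapted from BondHeatUncertaintySubdiffusiveBondHeatKernelGibbsA (`partialP_partialP_hamiltonian`)
  have h : partialP i (P.hamiltonian L) = fun y => y.2 i := funext fun y => P.partialP_hamiltonian L y i
  rw [h]
  simp only [partialP, Function.update_self]
  exact deriv_id _

/-- The Hamiltonian is a first integral of its own vector field: `X_H H = 0`. [folklore] -/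
theorem liouvilleOp_hamiltonian (P : OscillatorChain) (L : ℕ) (x : PhaseSpace L) :
    liouvilleOp P L (P.hamiltonian L) x = 0 := by
  unfold liouvilleOp
  refine Finset.sum_eq_zero fun i _ => ?_
  rw [P.partialP_hamiltonian]
  ring

/-- **Energy balance of the two end thermostats**: `S_{bathWeight} H = −((p_0² − T) + (p_{L−1}² − T))` for
`L ≥ 1` (`∂_{p_i} H = p_i`, `∂²_{p_i} H = 1`; Bonetto–Lebowitz–Rey-Bellet 2000 eq. (25)). [folklore] -/
theorem bathOp_bathWeight_hamiltonian (P : OscillatorChain) (hL : 0 < L) (T : ℝ) (x : PhaseSpace L) :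
    bathOp L (OscillatorChain.bathWeight L) T (P.hamiltonian L) x =
      -((kin L 0 x - T) + (kin L (L - 1) x - T)) := by
  have hL1 : L - 1 < L := by omega
  unfold bathOp OscillatorChain.bathWeight
  simp only [partialP_partialP_hamiltonian', P.partialP_hamiltonian, add_mul, Finset.sum_add_distrib,
    boole_mul]
  rw [sum_ite_val_eq hL, sum_ite_val_eq hL1, kin_eq_sq hL, kin_eq_sq hL1]
  ring

end Energy

/-! ## The cross Green identity without cutoff -/

section Cross

variable {ω₂ lam β γ : ℝ}

/-- **Cross Green identity, cutoff removed.** For the pinned chain (`ω₂ > 0`, `lam, β ≥ 0`), `T > 0`, weights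
`B ≥ 0`, friction `c > 0`, a `σ`-pair `(f, k_f)` and a `(−σ)`-pair `(h, k_h)` (`±σ X_H u + c S_B u = −k_u`
pointwise) with `f, h ∈ C² ∩ L²(μ_T)` and `k_f, k_h ∈ L²(μ_T)`:
`∫ h k_f e^{−H/T} = ∫ f k_h e^{−H/T}` — the `n → ∞` limit of `Kubo.cross_level`, the cutoff-gradient terms
vanishing by dominated convergence since `∂_{p_i} f, ∂_{p_i} h ∈ L²(μ_T)` wherever `B_i > 0`
(`Kubo.memLp_partialP`). [folklore] -/
theorem integral_cross_eq (hω : 0 < ω₂) (hl : 0 ≤ lam) (hβ : 0 ≤ β) (L : ℕ) {T : ℝ} (hT : 0 < T)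
    (B : Fin L → ℝ) (hB : ∀ i, 0 ≤ B i) (σ : ℝ) {c : ℝ} (hc : 0 < c)
    {f kf h kh : PhaseSpace L → ℝ} (hf : ContDiff ℝ 2 f) (hh : ContDiff ℝ 2 h)
    (hf2 : MemLp f 2 ((pinnedChain ω₂ lam β γ).gibbsMeasure L T))
    (hkf2 : MemLp kf 2 ((pinnedChain ω₂ lam β γ).gibbsMeasure L T))
    (hh2 : MemLp h 2 ((pinnedChain ω₂ lam β γ).gibbsMeasure L T))
    (hkh2 : MemLp kh 2 ((pinnedChain ω₂ lam β γ).gibbsMeasure L T))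
    (hpf : ∀ x, σ * liouvilleOp (pinnedChain ω₂ lam β γ) L f x + c * bathOp L B T f x = -kf x)
    (hph : ∀ x, -σ * liouvilleOp (pinnedChain ω₂ lam β γ) L h x + c * bathOp L B T h x = -kh x) :
    ∫ x, h x * kf x * (pinnedChain ω₂ lam β γ).gibbsDensity L T x =
      ∫ x, f x * kh x * (pinnedChain ω₂ lam β γ).gibbsDensity L T x := by
  set P := pinnedChain ω₂ lam β γ
  have hf1 : ContDiff ℝ 1 f := hf.of_le (by norm_cast)
  have hh1 : ContDiff ℝ 1 h := hh.of_le (by norm_cast)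
  have hfc : Continuous f := hf.continuous
  have hhc : Continuous h := hh.continuous
  have hdfc : ∀ i, Continuous (partialP i f) := fun i => continuous_partialP hf1 one_ne_zero i
  have hdhc : ∀ i, Continuous (partialP i h) := fun i => continuous_partialP hh1 one_ne_zero i
  have hkfc : Continuous kf := continuous_source B T σ c hf hpf
  have hkhc : Continuous kh := continuous_source B T (-σ) c hh hph
  -- integrability of the two limits
  have hI1 : Integrable fun x => h x * kf x * P.gibbsDensity L T x :=
    integrable_mul_mul_gibbsDensity hω hl hβ γ L hT hh2 hkf2
  have hI2 : Integrable fun x => f x * kh x * P.gibbsDensity L T x :=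
    integrable_mul_mul_gibbsDensity hω hl hβ γ L hT hf2 hkh2
  -- the two source terms converge
  have hlim1 : Tendsto (fun n : ℕ => ∫ x, chi P L n x * h x * kf x * P.gibbsDensity L T x) atTop
      (𝓝 (∫ x, h x * kf x * P.gibbsDensity L T x)) := by
    refine (tendsto_integral_chi_mul hω.le hl hβ γ L T (F := fun x => h x * kf x)
      (hhc.mul hkfc).aestronglyMeasurable hI1).congr fun n => ?_
    exact integral_congr_ae (ae_of_all _ fun x => by ring)
  have hlim2 : Tendsto (fun n : ℕ => ∫ x, chi P L n x * f x * kh x * P.gibbsDensity L T x) atTop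
      (𝓝 (∫ x, f x * kh x * P.gibbsDensity L T x)) := by
    refine (tendsto_integral_chi_mul hω.le hl hβ γ L T (F := fun x => f x * kh x)
      (hfc.mul hkhc).aestronglyMeasurable hI2).congr fun n => ?_
    exact integral_congr_ae (ae_of_all _ fun x => by ring)
  -- the cutoff-gradient terms vanish
  have hlim3 : ∀ i : Fin L, Tendsto (fun n : ℕ => B i * ∫ x, (h x * partialP i f x - f x * partialP i h x) *
      partialP i (chi P L n) x * P.gibbsDensity L T x) atTop (𝓝 0) := by
    intro i
    rcases (hB i).eq_or_lt with hi | hi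
    · rw [← hi]
      simp only [zero_mul]
      exact tendsto_const_nhds
    · have hdf2 : MemLp (partialP i f) 2 (P.gibbsMeasure L T) :=
        memLp_partialP hω hl hβ γ L hT B hB σ hc hf hf2 hkf2 hpf hi
      have hdh2 : MemLp (partialP i h) 2 (P.gibbsMeasure L T) :=
        memLp_partialP hω hl hβ γ L hT B hB (-σ) hc hh hh2 hkh2 hph hi
      have hFi : Integrable fun x => (h x * partialP i f x - f x * partialP i h x) * P.gibbsDensity L T x :=
        (integrable_mul_gibbsDensity_iff hω hl hβ γ L hT
          (fun x => h x * partialP i f x - f x * partialP i h x)).mpr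
          ((hh2.integrable_mul hdf2).sub (hf2.integrable_mul hdh2))
      have h0 := tendsto_integral_partialP_chi_mul hω hl hβ γ L T i
        (F := fun x => h x * partialP i f x - f x * partialP i h x)
        (by fun_prop : Continuous fun x => h x * partialP i f x - f x * partialP i h x).aestronglyMeasurable
        hFi
      have h1 := h0.const_mul (B i)
      rw [mul_zero] at h1
      refine h1.congr fun n => ?_
      congr 1
      exact integral_congr_ae (ae_of_all _ fun x => by ring)
  have hlim4 : Tendsto (fun n : ℕ => c * T * ∑ i, B i * ∫ x, (h x * partialP i f x - f x * partialP i h x) *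
      partialP i (chi P L n) x * P.gibbsDensity L T x) atTop (𝓝 0) := by
    have hs := tendsto_finsetSum (Finset.univ : Finset (Fin L)) fun i _ => hlim3 i
    rw [Finset.sum_const_zero] at hs
    have hs' := hs.const_mul (c * T)
    rw [mul_zero] at hs'
    exact hs'
  -- combine with the exact identity at level `n`
  have hlim5 := hlim1.sub hlim2
  have heq : ∀ n : ℕ, (∫ x, chi P L n x * h x * kf x * P.gibbsDensity L T x) -
      (∫ x, chi P L n x * f x * kh x * P.gibbsDensity L T x) =
      c * T * ∑ i, B i * ∫ x, (h x * partialP i f x - f x * partialP i h x) *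
        partialP i (chi P L n) x * P.gibbsDensity L T x :=
    fun n => cross_level hω hl hβ L hT B σ c hf hh hpf hph n
  have h0 : (∫ x, h x * kf x * P.gibbsDensity L T x) - (∫ x, f x * kh x * P.gibbsDensity L T x) = 0 :=
    tendsto_nhds_unique (hlim5.congr heq) hlim4
  exact sub_eq_zero.mp h0

end Cross

/-! ## The registered stub -/

/-- **F2 — ENERGY ROW SUM (fixed-`N`, size M).**  For `L ≥ 2` and every classical mean-zero `C² ∩ L²(μ_T)` left forward field
`g` (`L_{T,T} g = −(p_0² − T)`): `⟨g, p_0² − T⟩_{μ_T} + ⟨g, p_{L−1}² − T⟩_{μ_T} = T²/γ` — the spontaneous kinetic fluctuation of the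
left contact is eventually dissipated into the two baths (`L H = −γ(k_0 + k_{L−1})`, `⟨k_0, H⟩ = Var(p_0²)/2 = T²`).
Proof: `integral_cross_eq` with the forward pair `(g, k_0)` and the backward pair `(H, γ(k_0 + k_{L−1}))`, then
`⟨H, k_0⟩_{μ_T} = T⟨p_0, p_0⟩_{μ_T} = T²`. [folklore] -/
theorem stub_rowSum :
    ∀ (ω₂ lam β γ T : ℝ), 0 < ω₂ → 0 < lam → 0 < β → 0 < γ → 0 < T →
      ∀ (L : ℕ) (hL : 2 ≤ L) (g : PhaseSpace L → ℝ), ContDiff ℝ 2 g →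
        MemLp g 2 ((pinnedChain ω₂ lam β γ).gibbsMeasure L T) →
        ∫ x, g x ∂((pinnedChain ω₂ lam β γ).gibbsMeasure L T) = 0 →
        (∀ x, (pinnedChain ω₂ lam β γ).generator L T T g x = -(kin L 0 x - T)) →
        (∫ x, g x * (kin L 0 x - T) ∂((pinnedChain ω₂ lam β γ).gibbsMeasure L T)) +
          ∫ x, g x * (kin L (L - 1) x - T) ∂((pinnedChain ω₂ lam β γ).gibbsMeasure L T) = T ^ 2 / γ := by
  intro ω₂ lam β γ T hω hl hβ hγ hT L hL g hgC hgL2 _hg0 hgeq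
  have hL0 : 0 < L := by omega
  have hL1 : L - 1 < L := by omega
  set P := pinnedChain ω₂ lam β γ
  set μ := P.gibbsMeasure L T
  set H := P.hamiltonian L
  set B := OscillatorChain.bathWeight L with hB
  haveI : IsProbabilityMeasure μ := pinnedChain_isProbabilityMeasure_gibbsMeasure hω hl.le hβ.le γ L hT
  -- regularity of `H`
  have hHs : ContDiff ℝ ∞ H :=
    P.contDiff_hamiltonian (pinnedChain_contDiff_U ω₂ lam β γ) (pinnedChain_contDiff_V ω₂ lam β γ) L
  have hH2 : ContDiff ℝ 2 H := hHs.of_le (by norm_cast)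
  have hHd : Differentiable ℝ H := hH2.differentiable two_ne_zero
  have hHc : Continuous H := hHs.continuous
  have hH0 : ∀ x, 0 ≤ H x := fun x => pinnedChain_hamiltonian_nonneg hω.le hl.le hβ.le γ L x
  -- square integrability of the players
  have hHL2 : MemLp H 2 μ :=
    pinnedChain_memLp_two_of_abs_le hω hl.le hβ.le γ L hT hHc (C := 1) (k := 1) fun x => by
      rw [abs_of_nonneg (hH0 x), pow_one, one_mul]
      linarith [hH0 x]
  have hkinL2 : ∀ {s : ℕ}, s < L → MemLp (fun x => kin L s x - T) 2 μ := fun {s} hs =>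
    ((pinnedChain_memLp_two_snd_sq hω hl.le hβ.le γ L hT ⟨s, hs⟩).sub (memLp_const T)).ae_eq
      (ae_of_all _ fun x => by simp [kin_eq_sq hs])
  have hk0L2 : MemLp (fun x => kin L 0 x - T) 2 μ := hkinL2 hL0
  have hkRL2 : MemLp (fun x => kin L (L - 1) x - T) 2 μ := hkinL2 hL1
  have hkHL2 : MemLp (fun x => γ * ((kin L 0 x - T) + (kin L (L - 1) x - T))) 2 μ :=
    (hk0L2.add hkRL2).const_mul γ
  -- the two pairs
  have hB0 : ∀ i, 0 ≤ B i := by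
    intro i
    simp only [hB, OscillatorChain.bathWeight]
    positivity
  have hpg : ∀ x, 1 * liouvilleOp P L g x + γ * bathOp L B T g x = -(kin L 0 x - T) := by
    intro x
    have e := hgeq x
    rw [generator_eq_liouvilleOp_add] at e
    rw [one_mul]
    exact e
  have hpH : ∀ x, -1 * liouvilleOp P L H x + γ * bathOp L B T H x =
      -(γ * ((kin L 0 x - T) + (kin L (L - 1) x - T))) := by
    intro x
    rw [liouvilleOp_hamiltonian, bathOp_bathWeight_hamiltonian P hL0]
    ring
  -- the cross identity, cutoff removed, and its Gibbs-measure form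
  have hρeq : ∫ x, H x * (kin L 0 x - T) * P.gibbsDensity L T x =
      ∫ x, g x * (γ * ((kin L 0 x - T) + (kin L (L - 1) x - T))) * P.gibbsDensity L T x :=
    integral_cross_eq hω hl.le hβ.le L hT B hB0 1 hγ hgC hH2 hgL2 hk0L2 hHL2 hkHL2 hpg hpH
  have hμeq : ∫ x, g x * (γ * ((kin L 0 x - T) + (kin L (L - 1) x - T))) ∂μ =
      ∫ x, H x * (kin L 0 x - T) ∂μ := by
    rw [P.integral_gibbsMeasure, P.integral_gibbsMeasure, hρeq]
  -- `⟨H, p_0² − T⟩ = T²`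
  have hHk0 : ∫ x, H x * (kin L 0 x - T) ∂μ = T ^ 2 := by
    have hdH : ∀ x, partialP (⟨0, hL0⟩ : Fin L) H x = x.2 ⟨0, hL0⟩ := fun x => P.partialP_hamiltonian L x _
    have hdHL2 : MemLp (partialP (⟨0, hL0⟩ : Fin L) H) 2 μ := by
      rw [show partialP (⟨0, hL0⟩ : Fin L) H = fun x => x.2 ⟨0, hL0⟩ from funext hdH]
      exact pinnedChain_memLp_two_snd hω hl.le hβ.le γ L hT _
    have e1 : ∫ x, H x * (kin L 0 x - T) ∂μ = ∫ x, H x * (x.2 ⟨0, hL0⟩ ^ 2 - T) ∂μ :=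
      integral_congr_ae (ae_of_all _ fun x => by dsimp only; rw [kin_eq_sq hL0])
    have e2 : ∫ x, partialP (⟨0, hL0⟩ : Fin L) H x * x.2 ⟨0, hL0⟩ ∂μ = ∫ x, x.2 ⟨0, hL0⟩ ^ 2 ∂μ :=
      integral_congr_ae (ae_of_all _ fun x => by dsimp only; rw [hdH x]; ring)
    rw [e1, integral_mul_sq_sub_gibbsMeasure hω hl.le hβ.le γ L hT ⟨0, hL0⟩ hHd hHL2 hdHL2, e2,
      pinnedChain_integral_snd_sq hω hl.le hβ.le γ L hT ⟨0, hL0⟩]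
    ring
  -- split the pairing with `γ(k_0 + k_{L−1})`
  have hsplit : ∫ x, g x * (γ * ((kin L 0 x - T) + (kin L (L - 1) x - T))) ∂μ =
      γ * ((∫ x, g x * (kin L 0 x - T) ∂μ) + ∫ x, g x * (kin L (L - 1) x - T) ∂μ) := by
    have i1 : Integrable (fun x => g x * (kin L 0 x - T)) μ := hgL2.integrable_mul hk0L2
    have i2 : Integrable (fun x => g x * (kin L (L - 1) x - T)) μ := hgL2.integrable_mul hkRL2
    rw [← integral_add i1 i2, ← integral_const_mul]
    exact integral_congr_ae (ae_of_all _ fun x => by ring)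
  have hfin : γ * ((∫ x, g x * (kin L 0 x - T) ∂μ) + ∫ x, g x * (kin L (L - 1) x - T) ∂μ) = T ^ 2 := by
    rw [← hsplit, hμeq, hHk0]
  rw [eq_div_iff hγ.ne']
  linear_combination hfin

end Summit.AtomisticToContinuum.FouriersLaw.Cruxes.ConductanceLowerBound.ForecastSensitivity

end
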